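import Literature.AlgebraicGeometry.HodgeTheory.ProjectiveHyperplaneSectionHilbertPolynomial
import Literature.AlgebraicGeometry.HodgeTheory.ProjectiveCastelnuovoMumfordRegularity
import Literature.AlgebraicGeometry.HodgeTheory.ProjectiveDegreePositiveInteger
import Literature.Algebra.Homology.LaurentCechRegularLinearForm
import HarnessLib

/-!
# The degree is the length of a complementary linear section (Hartshorne I Thm. 7.7 iterated)

Hartshorne, *Algebraic Geometry*, I §7: the degree of `Y ⊆ ℙ^r` of dimension `t` is `t!` times the
leading coefficient of its Hilbert polynomial (Definition p. 52), a positive integer (Prop. 7.6 (a));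
and for a hypersurface `H` not containing `Y`, comparing Hilbert polynomials along
`0 → S/I_Y(-d) → S/I_Y → S/(I_Y + (f)) → 0` shows that `Y ∩ H` has dimension `t - 1` and
`(t-1)!·lc(P_{Y ∩ H}) = d · t!·lc(P_Y)` (proof of Thm. 7.7, p. 53). Iterating with `t` LINEAR forms,
each a non-zero-divisor modulo the saturation of the previous ideal (such forms exist over an
infinite field, `LaurentCechRegularLinearForm`), cuts `Y` down to a zero-dimensional scheme whose
constant Hilbert polynomial is `deg Y`: **the degree is the length of the intersection with a
suitable linear subspace of complementary dimension.**

In the tree's Čech language (`M = F_e ⧸ K`, `K` graded, `χ`-polynomial `Q` of degree `t`,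
`k` an infinite field):

* **`LaurentCech.exists_linearForms_hilbertPolynomial_eq_degree`** — there are non-zero linear forms
  `ℓ_1, …, ℓ_t` with `χ(Č_n(F_e ⧸ (K + (ℓ_1, …, ℓ_t) F_e))) = t! · lc(Q)` for EVERY `n`
  (the `χ`-polynomial of the linear section `M ⧸ (ℓ_1, …, ℓ_t) M` is the constant `deg M~`);
* `LaurentCech.exists_linearForms_hilbertPolynomial_eq_pos_int` — for `Q ≠ 0` that constant is a
  positive integer (`ProjectiveDegreePositiveInteger`).

The induction: replace `K` by its saturation `K̄` (same `χ`, `eulerChar_quot_sat_eq`), choose `ℓ`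
regular modulo `K̄` (`exists_linearForm_regular_sat`), use
`(t-1)!·lc(Q') = t!·lc(Q)` and `deg Q' = t - 1` for `Q' = Q - Q(z - 1)`
(`ProjectiveHyperplaneSectionHilbertPolynomial`), and at the end compare `K + (ℓ, ℓs)F_e` with
`(K̄ + ℓF_e) + (ℓs)F_e` — the former lies in the latter, which lies in the saturation of the former —
by saturation invariance (`isIso_homologyMap_quotRes_of_le_saturation`).

## References

* [Hartshorne1977] R. Hartshorne, *Algebraic Geometry*, GTM 52, Springer 1977, I §7: Definition of
  the degree (p. 52), Prop. 7.6 (a) (p. 52), Thm. 7.7 (proof, p. 53).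
-/

noncomputable section

open CategoryTheory CategoryTheory.Limits Polynomial Pointwise
open scoped Nat

universe u

namespace Literature.Algebra.Homology

namespace LaurentCech

open OrderedCech TopCohomology

variable {k : Type u} [Field k] [Infinite k] {r : ℕ} {J : Type} [Fintype J] (e : J → ℤ)

/-- **The degree is the length of a complementary linear section** (`k` infinite,
`K ⊆ F_e` graded with `χ`-polynomial `Q` of degree `t`): there are non-zero linear forms
`ℓ_1, …, ℓ_t` such that the `χ`-polynomial of `F_e ⧸ (K + (ℓ_1, …, ℓ_t)F_e)` — of the linear section
`M~ ∩ V(ℓ_1, …, ℓ_t)` — is the constant `t! · lc(Q) = deg M~`.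
[cite: Hartshorne1977, I Thm. 7.7 (proof, p. 53)] [cite: Hartshorne1977, I §7 Definition (p. 52)] -/
theorem exists_linearForms_hilbertPolynomial_eq_degree :
    ∀ (t : ℕ) (K : Submodule (P k r) (J → P k r)), IsGraded e K → ∀ {Q : ℚ[X]},
      (∀ n : ℤ, ((∑ q ∈ Finset.range (r + 1), (-1 : ℤ) ^ q *
        (Module.finrank k ((quot e K n).homology q) : ℤ) : ℤ) : ℚ) = Q.eval (n : ℚ)) →
      Q.natDegree = t →
      ∃ ls : List (P k r), ls.length = t ∧ (∀ ℓ ∈ ls, ℓ.IsHomogeneous 1 ∧ ℓ ≠ 0) ∧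
        ∀ n : ℤ, ((∑ q ∈ Finset.range (r + 1), (-1 : ℤ) ^ q *
          (Module.finrank k ((quot e (K ⊔ Ideal.ofList ls • (⊤ : Submodule (P k r) (J → P k r)))
            n).homology q) : ℤ) : ℤ) : ℚ) = ((Q.natDegree)! : ℚ) * Q.leadingCoeff := by
  intro t
  induction t with
  | zero =>
    intro K hK Q hQ ht
    refine ⟨[], rfl, fun ℓ hℓ => by simp at hℓ, fun n => ?_⟩
    have hKe : K ⊔ Ideal.ofList ([] : List (P k r)) • (⊤ : Submodule (P k r) (J → P k r)) = K := by
      rw [Ideal.ofList_nil, Submodule.bot_smul, sup_bot_eq]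
    rw [hKe, hQ n, ht, Nat.factorial_zero, Nat.cast_one, one_mul]
    conv_lhs => rw [eq_C_of_natDegree_eq_zero ht, eval_C]
    rw [leadingCoeff, ht]
  | succ t ih =>
    intro K hK Q hQ ht
    -- pass to the saturation: same `χ`-polynomial
    have hKs : IsGraded e (sat K) := isGraded_sat e hK
    have hQs : ∀ n : ℤ, ((∑ q ∈ Finset.range (r + 1), (-1 : ℤ) ^ q *
        (Module.finrank k ((quot e (sat K) n).homology q) : ℤ) : ℤ) : ℚ) = Q.eval (n : ℚ) :=
      fun n => by rw [eulerChar_quot_sat_eq e K n]; exact hQ n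
    -- a linear form regular modulo `K̄`
    obtain ⟨ℓ, hℓ0, hℓ1, hℓ, hreg⟩ := exists_linearForm_regular_sat (k := k) (r := r) (J := J) K
    have hK' : IsGraded e (sat K ⊔ ℓ • (⊤ : Submodule (P k r) (J → P k r))) :=
      isGraded_sup_smul_top e hKs hℓ
    obtain ⟨Q', hQ'⟩ := exists_polynomial_eulerChar_quot e hK'
    have ht1 : 1 ≤ Q.natDegree := by omega
    have hdeg : Q'.natDegree = t := by
      rw [natDegree_hilbertPolynomial_sup_smul_top e hKs ℓ hℓ hreg one_ne_zero hQs hQ' ht1, ht,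
        Nat.add_sub_cancel]
    have hlc : ((t)! : ℚ) * Q'.leadingCoeff = ((t + 1)! : ℚ) * Q.leadingCoeff := by
      have h := factorial_mul_leadingCoeff_hilbertPolynomial_sup_smul_top e hKs ℓ hℓ hreg
        one_ne_zero hQs hQ' ht1
      rw [ht, Nat.add_sub_cancel, Int.cast_one, one_mul] at h
      exact h
    -- induction hypothesis for the hyperplane section
    obtain ⟨ls, hlen, hls, hconst⟩ := ih _ hK' hQ' hdeg
    refine ⟨ℓ :: ls, by rw [List.length_cons, hlen], fun ℓ' hℓ' => ?_, fun n => ?_⟩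
    · rcases List.mem_cons.1 hℓ' with rfl | hmem
      · exact ⟨hℓ1, hℓ0⟩
      · exact hls ℓ' hmem
    · -- `K + (ℓ, ls)F_e ≤ (K̄ + ℓF_e) + (ls)F_e ≤ saturation of the former`
      have h1 : K ⊔ Ideal.ofList (ℓ :: ls) • (⊤ : Submodule (P k r) (J → P k r)) ≤
          (sat K ⊔ ℓ • (⊤ : Submodule (P k r) (J → P k r))) ⊔
            Ideal.ofList ls • (⊤ : Submodule (P k r) (J → P k r)) := by
        rw [Ideal.ofList_cons_smul, ← sup_assoc]
        exact sup_le_sup_right (sup_le_sup_right (le_sat K) _) _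
      have h2 : (sat K ⊔ ℓ • (⊤ : Submodule (P k r) (J → P k r))) ⊔
            Ideal.ofList ls • (⊤ : Submodule (P k r) (J → P k r)) ≤
          sat (K ⊔ Ideal.ofList (ℓ :: ls) • (⊤ : Submodule (P k r) (J → P k r))) := by
        refine sup_le (sup_le (sat_mono le_sup_left) ?_) ?_
        · refine le_trans ?_ (le_sat _)
          rw [Ideal.ofList_cons_smul]
          exact le_sup_right.trans' le_sup_left
        · refine le_trans ?_ (le_sat _)
          rw [Ideal.ofList_cons_smul]
          exact le_sup_right.trans' le_sup_right
      have hχ : ∑ q ∈ Finset.range (r + 1), (-1 : ℤ) ^ q *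
          (Module.finrank k ((quot e (K ⊔ Ideal.ofList (ℓ :: ls) •
            (⊤ : Submodule (P k r) (J → P k r))) n).homology q) : ℤ) =
          ∑ q ∈ Finset.range (r + 1), (-1 : ℤ) ^ q *
          (Module.finrank k ((quot e ((sat K ⊔ ℓ • (⊤ : Submodule (P k r) (J → P k r))) ⊔
            Ideal.ofList ls • (⊤ : Submodule (P k r) (J → P k r))) n).homology q) : ℤ) := by
        refine Finset.sum_congr rfl fun q _ => ?_
        haveI := isIso_homologyMap_quotRes_of_le_saturation e h1 (le_sat_iff.1 h2) n (q : ℤ)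
        rw [(asIso (HomologicalComplex.homologyMap (quotRes e _ _ h1 n) (q : ℤ))).toLinearEquiv.finrank_eq]
      rw [hχ, hconst n, hdeg, hlc, ht]

/-- **… and that length is a positive integer `deg M~`** when `Q ≠ 0`: the linear section
`F_e ⧸ (K + (ℓ_1, …, ℓ_t)F_e)` is zero-dimensional of constant Euler characteristic
`c = t!·lc(Q) ∈ ℕ_{>0}` in every twist. [cite: Hartshorne1977, I Prop. 7.6 (a) (p. 52)]
[cite: Hartshorne1977, I Thm. 7.7 (proof, p. 53)] -/
theorem exists_linearForms_hilbertPolynomial_eq_pos_int (hr : 1 ≤ r)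
    {K : Submodule (P k r) (J → P k r)} (hK : IsGraded e K) {Q : ℚ[X]}
    (hQ : ∀ n : ℤ, ((∑ q ∈ Finset.range (r + 1), (-1 : ℤ) ^ q *
      (Module.finrank k ((quot e K n).homology q) : ℤ) : ℤ) : ℚ) = Q.eval (n : ℚ)) (hQ0 : Q ≠ 0) :
    ∃ (ls : List (P k r)) (c : ℤ), ls.length = Q.natDegree ∧ (∀ ℓ ∈ ls, ℓ.IsHomogeneous 1 ∧ ℓ ≠ 0) ∧
      0 < c ∧ ((Q.natDegree)! : ℚ) * Q.leadingCoeff = c ∧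
      ∀ n : ℤ, ∑ q ∈ Finset.range (r + 1), (-1 : ℤ) ^ q *
        (Module.finrank k ((quot e (K ⊔ Ideal.ofList ls • (⊤ : Submodule (P k r) (J → P k r)))
          n).homology q) : ℤ) = c := by
  obtain ⟨ls, hlen, hls, hconst⟩ :=
    exists_linearForms_hilbertPolynomial_eq_degree e Q.natDegree K hK hQ rfl
  obtain ⟨c, hc, hQc⟩ := exists_pos_int_eq_factorial_mul_leadingCoeff_hilbertPolynomial e hr hK hQ hQ0
  refine ⟨ls, c, hlen, hls, hc, hQc, fun n => ?_⟩
  have h := hconst n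
  rw [hQc] at h
  exact_mod_cast h

end LaurentCech

end Literature.Algebra.Homology

end
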